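import Literature.AlgebraicGeometry.RealAlgebraic.RealLocusOvals
import Literature.AlgebraicGeometry.RealAlgebraic.ComplexOrientationFormulaGroundwork
import HarnessLib

/-!
# Slices of the insides of the ovals along a pencil of parallel lines (Rokhlin, layer 4)

Sibling proof file of `ComplexOrientationFormula.lean` (topic
`Literature/AlgebraicGeometry/RealAlgebraic`). Everything here is PROVED; no definition and no
named fact is introduced.

Let `p ∈ ℚ[x, y]` have compact real zero locus `Z` with `∇p ≠ 0` along it, let `O` be an oval
(connected component of `Z`) and `ℓ(y) = (ξ₀ + c y, y)` a line. At a TRANSVERSAL crossing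
`ℓ(y⋆) ∈ O` (`m = ⟪∇p(ℓ(y⋆)), (c, 1)⟫ ≠ 0`) the inside `ovalInterior O` lies, along `ℓ`, on
exactly one side of `y⋆` (`exists_sign_at_crossing`: the two signs of `p` near the point lie on
the two sides of the smooth Jordan curve `O`, `RealLocusOvals.sides_of_box`), and the side
`σ = ±1` (`+1`: inside below) is `sign(m) · gradOutwardSign`. If all crossings of `ℓ` with `O`
are transversal (a finite set `T`), then off `T`

  `[ℓ(t) ∈ ovalInterior O] = Σ_{y ∈ T, y > t} σ(y)`   (`indicator_slice_eq_sum`)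

(descending induction along the line: between crossings the line stays in one complementary
component of `O`; above all crossings it is in the unbounded one), whence the LENGTH of the
slice: `λ{y | ℓ(y) ∈ ovalInterior O} = Σ_{y ∈ T} σ(y) · y` (`volume_slice_toReal_eq_sum`).
This is the real, oval-by-oval input of the Cavalieri computation of
`Σ_O ε_O · Area(ovalInterior O)` in the proof of Rokhlin's complex orientation formula.
[folklore]

## References

* V. A. Rokhlin, Complex orientations of real algebraic curves, Funct. Anal. Appl. 8 (1974)
  331–334, §2. [Rokhlin1974]
-/

noncomputable section

open MvPolynomial Set Filter Metric MeasureTheory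
open scoped _root_.Topology

namespace Literature.AlgebraicGeometry.RealAlgebraic

namespace Slices

variable (p : MvPolynomial (Fin 2) ℚ)

/-! ### The line and the ovals -/

/-- The line `ℓ(y) = (ξ₀ + c y, y)` is `ℓ(y + s) = ℓ(y) + s • (c, 1)`. [folklore] -/
theorem line_add (ξ₀ c y s : ℝ) :
    (![ξ₀ + c * (y + s), y + s] : Fin 2 → ℝ) = ![ξ₀ + c * y, y] + s • ![c, 1] := by
  funext i
  fin_cases i
  · simp; ring
  · simp

/-- The line is continuous. [folklore] -/
theorem continuous_line (ξ₀ c : ℝ) : Continuous fun y : ℝ => (![ξ₀ + c * y, y] : Fin 2 → ℝ) := by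
  refine continuous_pi fun i => ?_
  fin_cases i
  · exact (continuous_const.add (continuous_const.mul continuous_id))
  · exact continuous_id

/-- The height is bounded by the norm of the point of the line. [folklore] -/
theorem abs_le_norm_line (ξ₀ c y : ℝ) : |y| ≤ ‖(![ξ₀ + c * y, y] : Fin 2 → ℝ)‖ := by
  have := norm_le_pi_norm (![ξ₀ + c * y, y] : Fin 2 → ℝ) 1
  simpa using this

/-- Membership in the inside is constant along preconnected sets off the oval. [folklore] -/
theorem mem_ovalInterior_iff_of_isPreconnected {O s : Set (Fin 2 → ℝ)} (hs : IsPreconnected s)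
    (hsO : s ⊆ Oᶜ) {u u' : Fin 2 → ℝ} (hu : u ∈ s) (hu' : u' ∈ s) :
    u ∈ ovalInterior O ↔ u' ∈ ovalInterior O := by
  have hcomp : connectedComponentIn Oᶜ u = connectedComponentIn Oᶜ u' := by
    have h1 : s ⊆ connectedComponentIn Oᶜ u := hs.subset_connectedComponentIn hu hsO
    exact connectedComponentIn_eq (h1 hu')
  simp only [mem_ovalInterior_iff, hcomp]
  exact ⟨fun h => ⟨fun h' => hsO hu' h', h.2⟩, fun h => ⟨fun h' => hsO hu h', h.2⟩⟩

/-! ### The side of the inside at a transversal crossing -/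

/-- **Sign of `p` along the line at a transversal zero**: if `m = ⟪∇p(ℓ(y⋆)), (c,1)⟫ ≠ 0`, then
for small `s > 0` the values `p(ℓ(y⋆ + s))` and `p(ℓ(y⋆ - s))` are non-zero with the signs of
`m` and `-m`. [folklore] -/
theorem eventually_sign_along_line {ξ₀ c y₀ : ℝ}
    (hy₀ : aeval (![ξ₀ + c * y₀, y₀] : Fin 2 → ℝ) p = 0) :
    ∀ᶠ s in 𝓝[>] (0 : ℝ),
      0 < (∑ i, realGrad p ![ξ₀ + c * y₀, y₀] i * (![c, 1] : Fin 2 → ℝ) i) *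
          aeval (![ξ₀ + c * (y₀ + s), y₀ + s] : Fin 2 → ℝ) p ∧
        (∑ i, realGrad p ![ξ₀ + c * y₀, y₀] i * (![c, 1] : Fin 2 → ℝ) i) *
          aeval (![ξ₀ + c * (y₀ - s), y₀ - s] : Fin 2 → ℝ) p < 0 ∨
      (∑ i, realGrad p ![ξ₀ + c * y₀, y₀] i * (![c, 1] : Fin 2 → ℝ) i) = 0 := by
  set v : Fin 2 → ℝ := ![ξ₀ + c * y₀, y₀] with hv
  set a : Fin 2 → ℝ := ![c, 1] with ha
  set m : ℝ := ∑ i, realGrad p v i * a i with hm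
  by_cases hm0 : m = 0
  · exact Eventually.of_forall fun _ => Or.inr hm0
  set f : ℝ → ℝ := fun s => aeval (v + s • a) p with hf
  have hderiv : HasDerivAt f m 0 := by
    have := hasDerivAt_aeval_lineMap p v a 0
    simpa [hf, hm] using this
  have hf0 : f 0 = 0 := by simp only [hf, zero_smul, add_zero]; exact hy₀
  have hslope : Tendsto (fun s => s⁻¹ * f s) (𝓝[≠] 0) (𝓝 m) := by
    have h := hderiv.tendsto_slope_zero
    simp only [zero_add, hf0, sub_zero, smul_eq_mul] at h
    exact h
  -- `s⁻¹ f(s)` has the sign of `m` near `0`, on both sides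
  have hpos : ∀ᶠ s in 𝓝[≠] (0 : ℝ), 0 < m * (s⁻¹ * f s) := by
    have : Tendsto (fun s => m * (s⁻¹ * f s)) (𝓝[≠] 0) (𝓝 (m * m)) := hslope.const_mul m
    exact this.eventually (lt_mem_nhds (mul_self_pos.2 hm0))
  have hright : ∀ᶠ s in 𝓝[>] (0 : ℝ), 0 < m * f s := by
    have h1 : ∀ᶠ s in 𝓝[>] (0 : ℝ), 0 < m * (s⁻¹ * f s) :=
      hpos.filter_mono (nhdsWithin_mono _ fun s hs => ne_of_gt hs)
    filter_upwards [h1, self_mem_nhdsWithin] with s hs hs0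
    have hs0' : (s : ℝ) ≠ 0 := ne_of_gt hs0
    have key : s * (m * (s⁻¹ * f s)) = m * f s := by field_simp
    linarith [mul_pos hs0 hs]
  have hleft : ∀ᶠ s in 𝓝[>] (0 : ℝ), m * f (-s) < 0 := by
    have hneg : Tendsto (fun s : ℝ => -s) (𝓝[>] (0 : ℝ)) (𝓝[≠] 0) := by
      refine tendsto_nhdsWithin_of_tendsto_nhds_of_eventually_within _ ?_ ?_
      · simpa using ((continuous_neg.tendsto (0 : ℝ)).mono_left nhdsWithin_le_nhds)
      · filter_upwards [self_mem_nhdsWithin] with s hs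
        exact neg_ne_zero.2 (ne_of_gt hs)
    have h1 := hneg.eventually hpos
    filter_upwards [h1, self_mem_nhdsWithin] with s hs hs0
    have hs0' : (s : ℝ) ≠ 0 := ne_of_gt hs0
    have key : s * (m * ((-s)⁻¹ * f (-s))) = -(m * f (-s)) := by field_simp
    linarith [mul_pos hs0 hs]
  filter_upwards [hright, hleft] with s hs1 hs2
  refine Or.inl ⟨?_, ?_⟩
  · simpa [hf, hv, ha, line_add] using hs1
  · have e : (![ξ₀ + c * (y₀ - s), y₀ - s] : Fin 2 → ℝ) = v + (-s) • a := by
      rw [hv, ha, sub_eq_add_neg, ← line_add]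
    rw [e]
    exact hs2

/-- **The inside lies on one side at a transversal crossing.** Let `ℓ(y⋆)` lie on the oval `O`
(component of the compact nonsingular real locus through `v₀`) with
`m = ⟪∇p(ℓ(y⋆)), (c,1)⟫ ≠ 0`. Then there is `σ = ±1` such that for all small `s > 0`,
`ℓ(y⋆ - s) ∈ ovalInterior O ↔ σ = 1` and `ℓ(y⋆ + s) ∈ ovalInterior O ↔ σ = -1`, and
`σ = sign(m) · gradOutwardSign p O (ℓ y⋆)`. [cite: Rokhlin1974, §2] -/
theorem exists_sign_at_crossing (hZ : IsCompact {u : Fin 2 → ℝ | aeval u p = 0})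
    (hreg : ∀ u : Fin 2 → ℝ, aeval u p = 0 → realGrad p u ≠ 0) {v₀ : Fin 2 → ℝ}
    {ξ₀ c y₀ : ℝ}
    (hy₀ : (![ξ₀ + c * y₀, y₀] : Fin 2 → ℝ) ∈ connectedComponentIn {u : Fin 2 → ℝ | aeval u p = 0} v₀)
    (hm : (∑ i, realGrad p ![ξ₀ + c * y₀, y₀] i * (![c, 1] : Fin 2 → ℝ) i) ≠ 0) :
    ∃ σ : ℤ, (σ = 1 ∨ σ = -1) ∧
      (∀ᶠ s in 𝓝[>] (0 : ℝ),
        ((![ξ₀ + c * (y₀ - s), y₀ - s] : Fin 2 → ℝ) ∈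
            ovalInterior (connectedComponentIn {u : Fin 2 → ℝ | aeval u p = 0} v₀) ↔ σ = 1) ∧
        ((![ξ₀ + c * (y₀ + s), y₀ + s] : Fin 2 → ℝ) ∈
            ovalInterior (connectedComponentIn {u : Fin 2 → ℝ | aeval u p = 0} v₀) ↔ σ = -1)) ∧
      (0 < (∑ i, realGrad p ![ξ₀ + c * y₀, y₀] i * (![c, 1] : Fin 2 → ℝ) i) →
        gradOutwardSign p (connectedComponentIn {u : Fin 2 → ℝ | aeval u p = 0} v₀) ![ξ₀ + c * y₀, y₀] = σ) ∧
      ((∑ i, realGrad p ![ξ₀ + c * y₀, y₀] i * (![c, 1] : Fin 2 → ℝ) i) < 0 →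
        gradOutwardSign p (connectedComponentIn {u : Fin 2 → ℝ | aeval u p = 0} v₀) ![ξ₀ + c * y₀, y₀] = -σ) := by
  set Z : Set (Fin 2 → ℝ) := {u | aeval u p = 0} with hZdef
  set v : Fin 2 → ℝ := ![ξ₀ + c * y₀, y₀] with hv
  set a : Fin 2 → ℝ := ![c, 1] with ha
  set m : ℝ := ∑ i, realGrad p v i * a i with hmdef
  have hvZ : aeval v p = 0 := (connectedComponentIn_subset Z v₀ hy₀ : v ∈ Z)
  have hO : connectedComponentIn Z v₀ = connectedComponentIn Z v := connectedComponentIn_eq hy₀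
  obtain ⟨e, he, heS, hconn, hunb, hclosed⟩ := exists_schoenflies_oval p hZ hreg hvZ
  rw [hO, ← heS]
  have hvS : v ∈ e '' sphere 0 1 := by rw [heS]; exact mem_connectedComponentIn hvZ
  have hS0 : ∀ u ∈ e '' sphere 0 1, aeval u p = 0 := fun u hu =>
    (connectedComponentIn_subset Z v (heS ▸ hu :) : u ∈ Z)
  have hW : (Z \ connectedComponentIn Z v)ᶜ ∈ 𝓝 v :=
    hclosed.isOpen_compl.mem_nhds fun h => h.2 (mem_connectedComponentIn hvZ)
  obtain ⟨B, hBW, hB, hvB, hpos, hneg⟩ := exists_box p hvZ (hreg v hvZ) hW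
  have hBZ : ∀ u ∈ B, aeval u p = 0 → u ∈ e '' sphere 0 1 := by
    intro u huB huZ
    rw [heS]
    by_contra h
    exact hBW huB ⟨huZ, h⟩
  have hint : ovalInterior (e '' sphere 0 1) = e '' ball 0 1 := ovalInterior_eq_image_ball he hconn hunb
  have hdisj := Literature.Topology.FourManifolds.SchoenfliesPlane.disjoint_image_ball_compl e
  -- along the line
  have hline : ∀ᶠ s in 𝓝[>] (0 : ℝ), v + s • a ∈ B ∧ v + (-s) • a ∈ B := by
    have h1 : Tendsto (fun s : ℝ => v + s • a) (𝓝[>] 0) (𝓝 v) := by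
      have : Continuous fun s : ℝ => v + s • a := by fun_prop
      simpa using (this.tendsto 0).mono_left nhdsWithin_le_nhds
    have h2 : Tendsto (fun s : ℝ => v + (-s) • a) (𝓝[>] 0) (𝓝 v) := by
      have : Continuous fun s : ℝ => v + (-s) • a := by fun_prop
      simpa using (this.tendsto 0).mono_left nhdsWithin_le_nhds
    exact (h1.eventually (hB.mem_nhds hvB)).and (h2.eventually (hB.mem_nhds hvB))
  have hsign := eventually_sign_along_line p (ξ₀ := ξ₀) (c := c) (y₀ := y₀) hvZ
  have e_add : ∀ s : ℝ, (![ξ₀ + c * (y₀ + s), y₀ + s] : Fin 2 → ℝ) = v + s • a := fun s => by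
    rw [hv, ha, line_add]
  have e_sub : ∀ s : ℝ, (![ξ₀ + c * (y₀ - s), y₀ - s] : Fin 2 → ℝ) = v + (-s) • a := fun s => by
    rw [hv, ha, sub_eq_add_neg, ← line_add]
  simp only [e_add, e_sub, hint]
  rcases sides_of_box p he hS0 hvS hB hvB hBZ hpos hneg with hout | hin
  · -- `{p > 0}` outside, `{p < 0}` inside: `gradOutwardSign = 1`, `σ = sign m`
    have hgos := gradOutwardSign_eq_one_of_sides p he hconn hunb hvZ (hreg v hvZ) hB hvB hout
    rcases lt_or_gt_of_ne hm with hmneg | hmpos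
    · refine ⟨-1, Or.inr rfl, ?_, fun h => absurd h (not_lt.2 hmneg.le), fun _ => by rw [hgos]; norm_num⟩
      filter_upwards [hline, hsign] with s hs hs'
      rcases hs' with ⟨h1, h2⟩ | h0
      · rw [e_add] at h1
        rw [e_sub] at h2
        have hp1 : aeval (v + s • a) p < 0 := by nlinarith
        have hp2 : 0 < aeval (v + (-s) • a) p := by nlinarith
        refine ⟨iff_of_false (fun hU => Set.disjoint_left.1 hdisj hU (hout.1 ⟨hs.2, hp2⟩)) (by norm_num),
          iff_of_true (hout.2 ⟨hs.1, hp1⟩) rfl⟩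
      · exact absurd h0 hm
    · refine ⟨1, Or.inl rfl, ?_, fun _ => hgos, fun h => absurd h (not_lt.2 hmpos.le)⟩
      filter_upwards [hline, hsign] with s hs hs'
      rcases hs' with ⟨h1, h2⟩ | h0
      · rw [e_add] at h1
        rw [e_sub] at h2
        have hp1 : 0 < aeval (v + s • a) p := by nlinarith
        have hp2 : aeval (v + (-s) • a) p < 0 := by nlinarith
        refine ⟨iff_of_true (hout.2 ⟨hs.2, hp2⟩) rfl,
          iff_of_false (fun hU => Set.disjoint_left.1 hdisj hU (hout.1 ⟨hs.1, hp1⟩)) (by norm_num)⟩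
      · exact absurd h0 hm
  · -- `{p > 0}` inside, `{p < 0}` outside: `gradOutwardSign = -1`, `σ = -sign m`
    have hgos := gradOutwardSign_eq_neg_one_of_sides p he hconn hunb hvZ (hreg v hvZ) hB hvB hin
    rcases lt_or_gt_of_ne hm with hmneg | hmpos
    · refine ⟨1, Or.inl rfl, ?_, fun h => absurd h (not_lt.2 hmneg.le), fun _ => by rw [hgos]⟩
      filter_upwards [hline, hsign] with s hs hs'
      rcases hs' with ⟨h1, h2⟩ | h0
      · rw [e_add] at h1
        rw [e_sub] at h2
        have hp1 : aeval (v + s • a) p < 0 := by nlinarith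
        have hp2 : 0 < aeval (v + (-s) • a) p := by nlinarith
        refine ⟨iff_of_true (hin.1 ⟨hs.2, hp2⟩) rfl,
          iff_of_false (fun hU => Set.disjoint_left.1 hdisj hU (hin.2 ⟨hs.1, hp1⟩)) (by norm_num)⟩
      · exact absurd h0 hm
    · refine ⟨-1, Or.inr rfl, ?_, fun _ => hgos, fun h => absurd h (not_lt.2 hmpos.le)⟩
      filter_upwards [hline, hsign] with s hs hs'
      rcases hs' with ⟨h1, h2⟩ | h0
      · rw [e_add] at h1
        rw [e_sub] at h2
        have hp1 : 0 < aeval (v + s • a) p := by nlinarith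
        have hp2 : aeval (v + (-s) • a) p < 0 := by nlinarith
        refine ⟨iff_of_false (fun hU => Set.disjoint_left.1 hdisj hU (hin.2 ⟨hs.2, hp2⟩)) (by norm_num),
          iff_of_true (hin.1 ⟨hs.1, hp1⟩) rfl⟩
      · exact absurd h0 hm


/-! ### Counting the inside along the line -/

/-- **The inside along a line, counted from above.** Let `T` be the (finite) set of heights at
which the line `ℓ` meets the set `O`, each crossing carrying a side `σ = ±1` as in
`exists_sign_at_crossing`. Then for `t ∉ T`:
`[ℓ(t) ∈ ovalInterior O] = Σ_{y ∈ T, y > t} σ(y)`. [folklore] -/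
theorem indicator_slice_eq_sum {ξ₀ c : ℝ} {O : Set (Fin 2 → ℝ)}
    [DecidablePred fun u : Fin 2 → ℝ => u ∈ ovalInterior O] (T : Finset ℝ)
    (hT : ∀ y : ℝ, (![ξ₀ + c * y, y] : Fin 2 → ℝ) ∈ O ↔ y ∈ T) (σ : ℝ → ℤ)
    (hσ : ∀ y ∈ T, ∀ᶠ s in 𝓝[>] (0 : ℝ),
      ((![ξ₀ + c * (y - s), (y - s)] : Fin 2 → ℝ) ∈ ovalInterior O ↔ σ y = 1) ∧ ((![ξ₀ + c * (y + s), (y + s)] : Fin 2 → ℝ) ∈ ovalInterior O ↔ σ y = -1))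
    (hσ1 : ∀ y ∈ T, σ y = 1 ∨ σ y = -1) (t : ℝ) (ht : t ∉ T) :
    (if (![ξ₀ + c * t, t] : Fin 2 → ℝ) ∈ ovalInterior O then (1 : ℤ) else 0) = ∑ y ∈ T.filter (fun y => t < y), σ y := by
  classical
  suffices h : ∀ n : ℕ, ∀ t : ℝ, t ∉ T → (T.filter (fun y => t < y)).card = n →
      (if (![ξ₀ + c * t, t] : Fin 2 → ℝ) ∈ ovalInterior O then (1 : ℤ) else 0) = ∑ y ∈ T.filter (fun y => t < y), σ y from
    h _ t ht rfl
  intro n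
  induction n with
  | zero =>
    intro t ht hcard
    have hempty : T.filter (fun y => t < y) = ∅ := Finset.card_eq_zero.1 hcard
    rw [hempty, Finset.sum_empty]
    have hray : ∀ s, t ≤ s → (![ξ₀ + c * s, s] : Fin 2 → ℝ) ∉ O := by
      intro s hs hsO
      have hsT := (hT s).1 hsO
      rcases hs.lt_or_eq with h | h
      · have : s ∈ T.filter (fun y => t < y) := Finset.mem_filter.2 ⟨hsT, h⟩
        rw [hempty] at this
        exact Finset.notMem_empty s this
      · rw [← h] at hsT
        exact ht hsT
    rw [if_neg]
    intro hin
    have hpre : IsPreconnected ((fun s : ℝ => (![ξ₀ + c * s, s] : Fin 2 → ℝ)) '' Ici t) :=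
      isPreconnected_Ici.image _ (continuous_line ξ₀ c).continuousOn
    have hsub : (fun s : ℝ => (![ξ₀ + c * s, s] : Fin 2 → ℝ)) '' Ici t ⊆ Oᶜ := by
      rintro _ ⟨s, hs, rfl⟩
      exact hray s hs
    have hcomp : (fun s : ℝ => (![ξ₀ + c * s, s] : Fin 2 → ℝ)) '' Ici t ⊆ connectedComponentIn Oᶜ (![ξ₀ + c * t, t] : Fin 2 → ℝ) :=
      hpre.subset_connectedComponentIn ⟨t, self_mem_Ici, rfl⟩ hsub
    obtain ⟨C, hC⟩ := (hin.2.subset hcomp).exists_norm_le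
    have hmem : (![ξ₀ + c * (max t (C + 1)), (max t (C + 1))] : Fin 2 → ℝ) ∈ (fun s : ℝ => (![ξ₀ + c * s, s] : Fin 2 → ℝ)) '' Ici t :=
      ⟨max t (C + 1), (le_max_left t (C + 1) : t ≤ max t (C + 1)), rfl⟩
    have h1 := hC _ hmem
    have h2 := abs_le_norm_line ξ₀ c (max t (C + 1))
    have h3 : C + 1 ≤ |max t (C + 1)| := (le_max_right _ _).trans (le_abs_self _)
    linarith
  | succ n ih =>
    intro t ht hcard
    have hne : (T.filter (fun y => t < y)).Nonempty := Finset.card_pos.1 (by omega)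
    set y₁ : ℝ := (T.filter (fun y => t < y)).min' hne with hy₁
    have hy₁mem : y₁ ∈ T.filter (fun y => t < y) := Finset.min'_mem _ _
    obtain ⟨hy₁T, hty₁⟩ := Finset.mem_filter.1 hy₁mem
    have hmin : ∀ y ∈ T, t < y → y₁ ≤ y := fun y hy hty =>
      Finset.min'_le _ _ (Finset.mem_filter.2 ⟨hy, hty⟩)
    -- the segment `[t, y₁)` misses `O`
    have hseg : ∀ s, t ≤ s → s < y₁ → (![ξ₀ + c * s, s] : Fin 2 → ℝ) ∉ O := by
      intro s hts hsy hsO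
      have hsT := (hT s).1 hsO
      rcases hts.lt_or_eq with h | h
      · exact absurd (hmin s hsT h) (not_le.2 hsy)
      · rw [← h] at hsT
        exact ht hsT
    have hconst : ∀ s, t ≤ s → s < y₁ → ((![ξ₀ + c * s, s] : Fin 2 → ℝ) ∈ ovalInterior O ↔ (![ξ₀ + c * t, t] : Fin 2 → ℝ) ∈ ovalInterior O) := by
      intro s hts hsy
      have hpre : IsPreconnected ((fun s : ℝ => (![ξ₀ + c * s, s] : Fin 2 → ℝ)) '' Ico t y₁) :=
        isPreconnected_Ico.image _ (continuous_line ξ₀ c).continuousOn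
      have hsub : (fun s : ℝ => (![ξ₀ + c * s, s] : Fin 2 → ℝ)) '' Ico t y₁ ⊆ Oᶜ := by
        rintro _ ⟨s', hs', rfl⟩
        exact hseg s' hs'.1 hs'.2
      exact mem_ovalInterior_iff_of_isPreconnected hpre hsub ⟨s, ⟨hts, hsy⟩, rfl⟩
        ⟨t, ⟨le_rfl, hty₁⟩, rfl⟩
    -- a small step beyond `y₁`
    have hev : ∀ᶠ s in 𝓝[>] (0 : ℝ),
        (((![ξ₀ + c * (y₁ - s), (y₁ - s)] : Fin 2 → ℝ) ∈ ovalInterior O ↔ σ y₁ = 1) ∧ ((![ξ₀ + c * (y₁ + s), (y₁ + s)] : Fin 2 → ℝ) ∈ ovalInterior O ↔ σ y₁ = -1)) ∧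
        t < y₁ - s ∧ ∀ y ∈ T, y₁ < y → y₁ + s < y := by
      refine (hσ y₁ hy₁T).and (Eventually.and ?_ ?_)
      · have : Iio (y₁ - t) ∈ 𝓝[>] (0 : ℝ) := mem_nhdsWithin_of_mem_nhds (Iio_mem_nhds (by linarith))
        filter_upwards [this] with s hs
        rw [mem_Iio] at hs
        linarith
      · refine (T.eventually_all).2 fun y _ => ?_
        by_cases hyy : y₁ < y
        · have : Iio (y - y₁) ∈ 𝓝[>] (0 : ℝ) := mem_nhdsWithin_of_mem_nhds (Iio_mem_nhds (by linarith))
          filter_upwards [this] with s hs _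
          rw [mem_Iio] at hs
          linarith
        · exact Eventually.of_forall fun s h => absurd h hyy
    obtain ⟨s, ⟨⟨hb1, hb2⟩, hts, hnext⟩, hs0⟩ := (hev.and self_mem_nhdsWithin).exists
    replace hs0 : 0 < s := hs0
    have hval_t : ((![ξ₀ + c * t, t] : Fin 2 → ℝ) ∈ ovalInterior O ↔ σ y₁ = 1) :=
      (hconst (y₁ - s) hts.le (by linarith)).symm.trans hb1
    have ht'T : y₁ + s ∉ T := by
      intro h
      have := hnext (y₁ + s) h (by linarith)
      linarith
    have hfilter : T.filter (fun y => y₁ + s < y) = (T.filter (fun y => t < y)).erase y₁ := by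
      ext y
      simp only [Finset.mem_filter, Finset.mem_erase]
      constructor
      · rintro ⟨hyT, hy⟩
        exact ⟨by intro h; rw [h] at hy; linarith, hyT, by linarith⟩
      · rintro ⟨hne, hyT, hty⟩
        exact ⟨hyT, hnext y hyT (lt_of_le_of_ne (hmin y hyT hty) (Ne.symm hne))⟩
    have hcard' : (T.filter (fun y => y₁ + s < y)).card = n := by
      rw [hfilter, Finset.card_erase_of_mem hy₁mem, hcard]
      rfl
    have hval_t' := ih (y₁ + s) ht'T hcard'
    rw [hfilter, Finset.sum_erase_eq_sub hy₁mem] at hval_t'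
    rcases hσ1 y₁ hy₁T with h1 | h1
    · rw [if_pos (hval_t.2 h1)]
      rw [if_neg (fun h => by have := hb2.1 h; omega)] at hval_t'
      omega
    · rw [if_neg (fun h => by have := hval_t.1 h; omega)]
      rw [if_pos (hb2.2 h1)] at hval_t'
      omega

/-! ### The length of the slice -/

/-- **Length of the slice of the inside.** With `O` compact and `T`, `σ` as above,
`λ {y | ℓ(y) ∈ ovalInterior O} = Σ_{y ∈ T} σ(y) · y`. [folklore] -/
theorem volume_slice_toReal_eq_sum {ξ₀ c : ℝ} {O : Set (Fin 2 → ℝ)} (hO : IsCompact O)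
    (T : Finset ℝ) (hT : ∀ y : ℝ, (![ξ₀ + c * y, y] : Fin 2 → ℝ) ∈ O ↔ y ∈ T) (σ : ℝ → ℤ)
    (hσ : ∀ y ∈ T, ∀ᶠ s in 𝓝[>] (0 : ℝ),
      ((![ξ₀ + c * (y - s), (y - s)] : Fin 2 → ℝ) ∈ ovalInterior O ↔ σ y = 1) ∧ ((![ξ₀ + c * (y + s), (y + s)] : Fin 2 → ℝ) ∈ ovalInterior O ↔ σ y = -1))
    (hσ1 : ∀ y ∈ T, σ y = 1 ∨ σ y = -1) :
    (volume {y : ℝ | (![ξ₀ + c * y, y] : Fin 2 → ℝ) ∈ ovalInterior O}).toReal = ∑ y ∈ T, (σ y : ℝ) * y := by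
  classical
  obtain ⟨r, hr⟩ := hO.isBounded.subset_closedBall 0
  set R : ℝ := max r 0 with hR
  have hR0 : 0 ≤ R := le_max_right _ _
  have hOR : O ⊆ closedBall 0 R := hr.trans (closedBall_subset_closedBall (le_max_left _ _))
  have hint : ovalInterior O ⊆ closedBall 0 R := ovalInterior_subset_closedBall hR0 hOR
  set S : Set ℝ := {y : ℝ | (![ξ₀ + c * y, y] : Fin 2 → ℝ) ∈ ovalInterior O} with hS
  have hSmeas : MeasurableSet S :=
    ((isOpen_ovalInterior_of_isCompact hO).preimage (continuous_line ξ₀ c)).measurableSet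
  have hSbdd : ∀ y ∈ S, |y| ≤ R := fun y hy =>
    (abs_le_norm_line ξ₀ c y).trans (mem_closedBall_zero_iff.1 (hint hy))
  have hTbdd : ∀ y ∈ T, |y| ≤ R := fun y hy =>
    (abs_le_norm_line ξ₀ c y).trans (mem_closedBall_zero_iff.1 (hOR ((hT y).2 hy)))
  set a : ℝ := -R - 1 with ha
  have hay : ∀ y ∈ T, a ≤ y := fun y hy => by
    have := hTbdd y hy; have := neg_abs_le y; linarith
  -- the indicator of the slice as a signed sum of indicators of intervals, off `T`
  have hind : ∀ t, (![ξ₀ + c * t, t] : Fin 2 → ℝ) ∈ ovalInterior O ∨ (![ξ₀ + c * t, t] : Fin 2 → ℝ) ∉ ovalInterior O := fun t => em _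
  have hpt : ∀ t, t ∉ T →
      S.indicator (1 : ℝ → ℝ) t = ∑ y ∈ T, (σ y : ℝ) * (Ico a y).indicator 1 t := by
    intro t ht
    by_cases hta : t < a
    · have htS : t ∉ S := fun h => by
        have := hSbdd t h; have := neg_abs_le t; linarith
      rw [indicator_of_notMem htS]
      symm
      refine Finset.sum_eq_zero fun y _ => ?_
      rw [indicator_of_notMem (fun h => absurd h.1 (not_le.2 hta)), mul_zero]
    · push Not at hta
      have key := indicator_slice_eq_sum T hT σ hσ hσ1 t ht
      have h1 : S.indicator (1 : ℝ → ℝ) t =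
          ((if (![ξ₀ + c * t, t] : Fin 2 → ℝ) ∈ ovalInterior O then (1 : ℤ) else 0 : ℤ) : ℝ) := by
        by_cases h : (![ξ₀ + c * t, t] : Fin 2 → ℝ) ∈ ovalInterior O
        · rw [indicator_of_mem (show t ∈ S from h), if_pos h]; simp
        · rw [indicator_of_notMem (show t ∉ S from h), if_neg h]; simp
      rw [h1, key, Int.cast_sum, Finset.sum_filter]
      refine Finset.sum_congr rfl fun y _ => ?_
      by_cases hty : t < y
      · rw [if_pos hty, indicator_of_mem (show t ∈ Ico a y from ⟨hta, hty⟩)]; simp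
      · rw [if_neg hty, indicator_of_notMem (show t ∉ Ico a y from fun h => hty h.2)]; simp
  have hae : (fun t => S.indicator (1 : ℝ → ℝ) t) =ᵐ[volume]
      fun t => ∑ y ∈ T, (σ y : ℝ) * (Ico a y).indicator 1 t := by
    filter_upwards [T.finite_toSet.countable.ae_notMem volume] with t ht
    exact hpt t ht
  -- the total sign is zero: look below everything
  have hsum0 : ∑ y ∈ T, (σ y : ℝ) = 0 := by
    have ht₀T : a - 1 ∉ T := fun h => by have := hay _ h; linarith
    have key := indicator_slice_eq_sum T hT σ hσ hσ1 (a - 1) ht₀T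
    have hout : (![ξ₀ + c * (a - 1), (a - 1)] : Fin 2 → ℝ) ∉ ovalInterior O := fun h => by
      have := hSbdd (a - 1) h; have := neg_abs_le (a - 1); linarith
    rw [if_neg hout, Finset.filter_true_of_mem (fun y hy => by have := hay y hy; linarith)] at key
    exact_mod_cast key.symm
  have hint_one : ∀ y ∈ T, ∫ t, (Ico a y).indicator (1 : ℝ → ℝ) t = y - a := by
    intro y hy
    rw [integral_indicator_one measurableSet_Ico, measureReal_def, Real.volume_Ico,
      ENNReal.toReal_ofReal]
    linarith [hay y hy]
  have hint_int : ∀ y : ℝ, Integrable ((Ico a y).indicator (1 : ℝ → ℝ)) volume := fun y =>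
    (integrableOn_const (measure_Ico_lt_top (a := a) (b := y)).ne).integrable_indicator
      measurableSet_Ico
  have hswap : ∫ t, ∑ y ∈ T, (σ y : ℝ) * (Ico a y).indicator 1 t = ∑ y ∈ T, (σ y : ℝ) * (y - a) := by
    rw [integral_finsetSum _ (fun y _ => (hint_int y).const_mul _)]
    refine Finset.sum_congr rfl fun y hy => ?_
    rw [integral_const_mul, hint_one y hy]
  calc (volume S).toReal = ∫ t, S.indicator 1 t := by
        rw [← measureReal_def]; exact (integral_indicator_one hSmeas).symm
    _ = ∫ t, ∑ y ∈ T, (σ y : ℝ) * (Ico a y).indicator 1 t := integral_congr_ae hae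
    _ = ∑ y ∈ T, (σ y : ℝ) * (y - a) := hswap
    _ = ∑ y ∈ T, (σ y : ℝ) * y - a * ∑ y ∈ T, (σ y : ℝ) := by
        rw [Finset.mul_sum, ← Finset.sum_sub_distrib]
        exact Finset.sum_congr rfl fun y _ => by ring
    _ = ∑ y ∈ T, (σ y : ℝ) * y := by rw [hsum0, mul_zero, sub_zero]

end Slices

end Literature.AlgebraicGeometry.RealAlgebraic
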